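import Literature.AlgebraicGeometry.Motives.UniversalHyperplaneSectionSmoothNear
import HarnessLib

/-!
# The universal hyperplane section is a smooth `ℙᴺ⁻¹`-bundle over `X`: smoothness

Topic `Literature/AlgebraicGeometry/Motives` (theorems only; no definitions, no named facts).
For an affine (e.g. closed) immersion `ι : X ⟶ ℙᴺ_k` of a reduced `k`-scheme `X`, `N ≥ 1`, the
projection `j = pr₁ : 𝒳 = {(x, a) | Σᵢ aᵢ xᵢ(x) = 0} ⟶ X` of the universal hyperplane section
(`Motives/UniversalHyperplaneSection`, `UniversalHyperplaneSection.toX`) is **smooth of relative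
dimension `N - 1`** (`smoothOfRelativeDimension_toX_left`): "the incidence variety is a
`ℙᴺ⁻¹`-bundle over `X`" (Voisin II §2.1.1). Consequently, if `X → Spec k` is smooth of relative
dimension `n`, then `𝒳 → Spec k` is smooth of relative dimension `n + (N - 1)`
(`smoothOfRelativeDimension_hom`).

Proof: the local models of `Motives/UniversalHyperplaneSectionSmoothNear` — over a chart
`X' × D₊(a_l)`, `X' ⊆ ι⁻¹D₊(x_j)` affine, `j ≠ l`, the piece of `𝒳` is the graph
`Spec Γ(X, X')[aᵢ/a_l : i ≠ j, l] ≅ 𝔸ᴺ⁻¹_{X'}` (`exists_modelIso`), whose projection to `X'` is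
`Spec` of a polynomial algebra in `N - 1` variables, standard smooth of relative dimension `N - 1`
(the tautological submersive presentation: no relations, Jacobian `1`); smoothness of a fixed
relative dimension is local on the source (Mathlib `IsZariskiLocalAtSource`).

## References

* [VoisinHodgeII2003] C. Voisin, Hodge Theory and Complex Algebraic Geometry II, CUP 2003, §2.1.1
  (the incidence variety is a projective bundle over `X`), §3.2.2.
* [Hartshorne1977] R. Hartshorne, Algebraic Geometry, III §10 Example 10.0.1 and Prop. 10.1.
-/

noncomputable section

open CategoryTheory AlgebraicGeometry Limits MonoidalCategory CartesianMonoidalCategory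
  HomogeneousLocalization TensorProduct

universe u

namespace Literature.AlgebraicGeometry.Motives.UniversalHyperplaneSection

/-! ### The polynomial algebra is standard smooth -/

/-- The polynomial algebra `A[yᵢ | i ∈ σ]` on finitely many variables is standard smooth over `A`
of relative dimension `#σ`: the tautological presentation (generators `yᵢ`, no relations) is
submersive with Jacobian `1` (cf. the same statement in
`NumberTheory/Transcendental/AnalytificationAffineSpaceProofs`, not imported here).
[cite: Hartshorne1977, III §10 Example 10.0.1] -/
theorem isStandardSmoothOfRelativeDimension_mvPolynomial' (A : Type u) [CommRing A] (σ : Type)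
    [Finite σ] : Algebra.IsStandardSmoothOfRelativeDimension (Nat.card σ) A (MvPolynomial σ A) := by
  classical
  let P₀ : Algebra.PreSubmersivePresentation A (MvPolynomial σ A) σ PEmpty.{1} :=
    { toGenerators := Algebra.Generators.mvPolynomial A σ
      relation := PEmpty.elim
      span_range_relation_eq_ker := by
        rw [Set.range_eq_empty, Ideal.span_empty, Algebra.Generators.ker_mvPolynomial]
      map := PEmpty.elim
      map_inj := fun a ↦ a.elim }
  let P : Algebra.SubmersivePresentation A (MvPolynomial σ A) σ PEmpty.{1} :=
    { __ := P₀
      jacobian_isUnit := by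
        rw [Algebra.PreSubmersivePresentation.jacobian_eq_jacobiMatrix_det, Matrix.det_isEmpty,
          map_one]
        exact isUnit_one }
  exact P.isStandardSmoothOfRelativeDimension (by simp [Algebra.Presentation.dimension])

/-- `Spec A[yᵢ | i ∈ σ] → Spec A` is smooth of relative dimension `#σ`.
[cite: Hartshorne1977, III §10 Example 10.0.1] -/
theorem smoothOfRelativeDimension_SpecMap_algebraMap_mvPolynomial (A : Type u) [CommRing A]
    (σ : Type) [Finite σ] :
    SmoothOfRelativeDimension (Nat.card σ)
      (Spec.map (CommRingCat.ofHom (algebraMap A (MvPolynomial σ A)))) := by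
  refine (HasRingHomProperty.Spec_iff (P := @SmoothOfRelativeDimension (Nat.card σ))).mpr ?_
  rw [CommRingCat.hom_ofHom]
  refine RingHom.locally_of RingHom.isStandardSmoothOfRelativeDimension_respectsIso _ ?_
  exact (RingHom.isStandardSmoothOfRelativeDimension_algebraMap (Nat.card σ)).mpr
    (isStandardSmoothOfRelativeDimension_mvPolynomial' A σ)

/-! ### The projection `𝒳 ⟶ X` is smooth of relative dimension `N - 1` -/

section Smooth

variable {k : Type u} [Field k] {N : ℕ} {X : SchemeOver k} (ι : X ⟶ projectiveSpace N k)

/-- The index type `{m : Fin N // m ≠ m₀}` of the variables of the local model has `N - 1` elements.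
[folklore] -/
theorem natCard_idx (m₀ : Fin N) : Nat.card (HyperplaneSectionChart.Idx m₀) = N - 1 := by
  classical
  rw [Nat.card_eq_fintype_card]
  change Fintype.card {m : Fin N // ¬ (m = m₀)} = N - 1
  rw [Fintype.card_subtype_compl, Fintype.card_fin, Fintype.card_subtype_eq]

/-- **Local smoothness of `j : 𝒳 ⟶ X`**: every point of the universal hyperplane section of a
reduced `X` along an affine `ι : X ⟶ ℙᴺ` has an open neighbourhood — the piece over a chart
`X' × D₊(a_l)` with `X' = ι⁻¹D₊(x_j)`, `j ≠ l`, which is the graph `Spec Γ(X, X')[aᵢ/a_l : i ≠ j, l]`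
— on which `j` is `Spec` of a polynomial algebra in `N - 1` variables over `Γ(X, X')` followed by
`X' ↪ X`, hence smooth of relative dimension `N - 1`. [cite: VoisinHodgeII2003, §2.1.1] -/
theorem exists_isOpenImmersion_smoothOfRelativeDimension_comp_toX [IsReduced X.left] [IsAffineHom ι.left]
    (x : (universalHyperplaneSection N ι).left) :
    ∃ (M : Scheme.{u}) (u : M ⟶ (universalHyperplaneSection N ι).left), IsOpenImmersion u ∧
      x ∈ Set.range u ∧ SmoothOfRelativeDimension (N - 1) (u ≫ (toX N ι).left) := by
  classical
  -- the file-local instances of `Motives/UniversalHyperplaneSectionChart` (grading of `k[x]`,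
  -- `k`-algebra structures of the chart rings), as local hypotheses
  letI := MvPolynomial.gradedAlgebra (σ := Fin (N + 1)) (R := k)
  letI : ∀ l : Fin (N + 1), Algebra k (chartBaseRing (k := k) N l) := chartBaseRingAlgebra
  letI : ∀ U : X.left.Opens, Algebra k Γ(X.left, U) := sectionsAlgebra X
  -- the chart `X' × D₊(a_l)`, `X' = ι⁻¹D₊(x_j)` affine, `j = l.succAbove m₀`
  obtain ⟨j, l, hjl, hj, hl⟩ := exists_chart_indices N ι x
  obtain ⟨m₀, hm₀⟩ : ∃ m₀ : Fin N, l.succAbove m₀ = j := Fin.exists_succAbove_eq hjl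
  have hinst : IsAffineHom ι.left := inferInstance
  let X' : X.left.affineOpens := ⟨ι.left ⁻¹ᵁ Proj.basicOpen (Segre.grading (Fin (N + 1)) k) (MvPolynomial.X j),
    @IsAffineOpen.preimage _ _ _
      (ProjSubscheme.affineBasicOpen (Segre.grading (Fin (N + 1)) k) (MvPolynomial.X j) (Segre.X_mem k j) zero_lt_one).2 ι.left hinst⟩
  have hX' : (X' : X.left.Opens) ≤ ι.left ⁻¹ᵁ Proj.basicOpen (Segre.grading (Fin (N + 1)) k) (MvPolynomial.X j) := le_rfl
  have hpX' : (toX N ι).left x ∈ (X' : X.left.Opens) := hj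
  let A : Type u := Γ(X.left, (X' : X.left.Opens))
  let Mdl : Type u := HyperplaneSectionChart.Model A m₀
  -- the model `Spec A[y_m : m ≠ m₀] ≅ 𝒳 ∩ (X' × D₊(a_l))` and the open piece `u' : Spec Mdl ↪ 𝒳`
  obtain ⟨e, he⟩ := exists_modelIso ι j l X' m₀ hX' hm₀
  let u' : Spec (.of Mdl) ⟶ (universalHyperplaneSection N ι).left := e.hom ≫ chartSectionToSection ι l X'
  haveI : IsOpenImmersion u' := inferInstance
  have hxu : x ∈ Set.range u' := by
    have hx1 : x ∈ Set.range (chartSectionToSection ι l X') := by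
      have h' : (emb N ι).left x ∈ Set.range (chartImm X l X') :=
        (Set.ext_iff.mp (range_chartImm (X := X) l X') ((emb N ι).left x)).mpr ⟨hpX', hl⟩
      obtain ⟨y, hy⟩ := h'
      obtain ⟨w, hw1, -⟩ := Scheme.Pullback.exists_preimage_pullback (f := (emb N ι).left)
        (g := chartImm X l X') x y hy.symm
      exact ⟨w, hw1⟩
    obtain ⟨y, hy⟩ := hx1
    exact ⟨e.inv y, by
      rw [← hy]
      change (e.inv ≫ e.hom ≫ chartSectionToSection ι l X') y = _
      rw [Iso.inv_hom_id_assoc]⟩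
  -- `u' ≫ j = Spec (A → Mdl) ≫ (X' ↪ X)`
  have hu' : u' ≫ (toX N ι).left =
      Spec.map (CommRingCat.ofHom (algebraMap A Mdl)) ≫ X'.2.fromSpec := by
    calc u' ≫ (toX N ι).left
        = e.hom ≫ chartSectionToSection ι l X' ≫ (emb N ι).left ≫
            pullback.fst X.hom (dualProjectiveSpace N k).hom := by
          change (e.hom ≫ chartSectionToSection ι l X') ≫ (toX N ι).left = _
          rw [Category.assoc]; rfl
      _ = e.hom ≫ chartSectionι ι l X' ≫ chartImm X l X' ≫
            pullback.fst X.hom (dualProjectiveSpace N k).hom := by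
          rw [chartSectionToSection_emb_assoc]
          exact congrArg (e.hom ≫ ·) (Category.assoc _ _ _)
      _ = modelImm ι j l X' m₀ hX' ≫ Spec.map (CommRingCat.ofHom (algebraMap A (chartRing l X'))) ≫
            X'.2.fromSpec := by
          rw [chartImm_fst, ← he, Category.assoc]
      _ = Spec.map (CommRingCat.ofHom (algebraMap A Mdl)) ≫ X'.2.fromSpec := by
          rw [modelImm, ← Spec.map_comp_assoc, ← CommRingCat.ofHom_comp]
          congr 3
          exact (modelHom ι j l X' m₀ hX').comp_algebraMap
  -- smoothness of relative dimension `N - 1`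
  have h1 : SmoothOfRelativeDimension (N - 1) (Spec.map (CommRingCat.ofHom (algebraMap A Mdl))) := by
    rw [← natCard_idx m₀]
    exact smoothOfRelativeDimension_SpecMap_algebraMap_mvPolynomial A (HyperplaneSectionChart.Idx m₀)
  have h2 : SmoothOfRelativeDimension (N - 1 + 0)
      (Spec.map (CommRingCat.ofHom (algebraMap A Mdl)) ≫ X'.2.fromSpec) := inferInstance
  rw [Nat.add_zero, ← hu'] at h2
  exact ⟨_, u', inferInstance, hxu, h2⟩

/-- **The projection `j : 𝒳 ⟶ X` of the universal hyperplane section is smooth of relative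
dimension `N - 1`** for `X` reduced and `ι : X ⟶ ℙᴺ` affine (e.g. a closed immersion): "the
incidence variety is a `ℙᴺ⁻¹`-bundle over `X`" (Zariski-locally on `𝒳` it is the projection of the
affine space `𝔸ᴺ⁻¹_{X'}`, `exists_isOpenImmersion_smoothOfRelativeDimension_comp_toX`; smoothness of
a fixed relative dimension is local on the source). [cite: VoisinHodgeII2003, §2.1.1]
[cite: Hartshorne1977, III Prop. 10.1] -/
theorem smoothOfRelativeDimension_toX_left [IsReduced X.left] [IsAffineHom ι.left] :
    SmoothOfRelativeDimension (N - 1) (toX N ι).left := by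
  choose M u hu hx hsm using exists_isOpenImmersion_smoothOfRelativeDimension_comp_toX ι
  let 𝒰 : (universalHyperplaneSection N ι).left.OpenCover :=
    Scheme.Cover.mkOfCovers (universalHyperplaneSection N ι).left M u
      (fun x ↦ ⟨x, hx x⟩) (fun x ↦ hu x)
  exact IsZariskiLocalAtSource.of_openCover (P := @SmoothOfRelativeDimension (N - 1)) 𝒰
    (fun x ↦ hsm x)

/-- **The universal hyperplane section of a smooth `X` is smooth**: if `X → Spec k` is smooth of
relative dimension `n` (so `X` is reduced) and `ι : X ⟶ ℙᴺ` is affine, then `𝒳 → Spec k` is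
smooth of relative dimension `N - 1 + n` (`𝒳 → X → Spec k`, Hartshorne III Prop. 10.1 (c)).
[cite: VoisinHodgeII2003, §2.1.1 and §3.2.2] [cite: Hartshorne1977, III Prop. 10.1 (c)] -/
theorem smoothOfRelativeDimension_hom (n : ℕ) [SmoothOfRelativeDimension n X.hom] [IsAffineHom ι.left] :
    SmoothOfRelativeDimension (N - 1 + n) (universalHyperplaneSection N ι).hom := by
  haveI : Smooth X.hom := SmoothOfRelativeDimension.smooth n X.hom
  haveI : IsReduced X.left := isReduced_of_smooth_over_field X.hom
  haveI := smoothOfRelativeDimension_toX_left ι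
  rw [← Over.w (toX N ι)]
  infer_instance

end Smooth

end Literature.AlgebraicGeometry.Motives.UniversalHyperplaneSection

end
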